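import Literature.AlgebraicGeometry.Motives.MixedHodgeStructureCatPureObjects
import Literature.AlgebraicGeometry.Motives.MixedHodgeStructureCatGradedPolarizable
import Literature.AlgebraicGeometry.Motives.MixedHodgeStructureCatWeightGradedObjectSplitOverQ
import Literature.AlgebraicGeometry.Motives.MixedHodgeStructureSemisimple
import HarnessLib

/-!
# Semisimple objects of `MixedHodgeStructureCat` are the semisimple mixed Hodge structures; for graded-polarizable `X`: semisimple ⟺ `ℚ`-split

Layer `Literature/AlgebraicGeometry/Motives` (lane `lit-hodgefound`).  The tree has two notions of semisimplicity for a mixed Hodge structure: the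
CATEGORICAL `IsSemisimpleObj X` (`CategoryTheory/Abelian/SemisimpleObjects`: a finite biproduct of simple objects; for objects of finite length
`↔ ComplementedLattice (Subobject X)`, `isSemisimpleObj_iff_complementedLattice`) and the UNBUNDLED `MixedHodgeStructure.IsSemisimple H` (every
sub-MHS has a complementary sub-MHS, `Motives/MixedHodgeStructureSemisimple`), with the unbundled theorems `IsSemisimple ↔ IsSplitOverQ` for
graded-polarizable `H` (`IsGradedPolarizable.isSemisimple_iff_isSplitOverQ`).  This file identifies them through the order isomorphism
`subobjectEquiv X : Subobject X ≃o X.str.subLattice` (`Motives/MixedHodgeStructureCatSubobjects`):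

* §1 `subobjectEquiv` on `⊥`, `⊤`, `⊓`, `⊔` (as subspaces of `X`), and **`isCompl_coe_subobjectEquiv_iff`**;
* §2 **`complementedLattice_subobject_iff_isSemisimple : ComplementedLattice (Subobject X) ↔ X.str.IsSemisimple`** and, for finite-dimensional `X`,
  **`isSemisimpleObj_iff_isSemisimple : IsSemisimpleObj X ↔ X.str.IsSemisimple`** (cf. `simple_iff_isSimple` there);
* §3 for graded-polarizable `X`: **`isSemisimpleObj_iff_isSplitOverQ`**;
* §4 (appended, generation 45) combined with g44-#15 `isSplitOverQ_iff_nonempty_grTotal_obj_iso`: **`isSemisimpleObj_iff_nonempty_grTotal_obj_iso`** —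
  a graded-polarizable MHS is a semisimple object iff it is isomorphic to its associated weight-graded object `(grTotal s).obj X = ⨁_{j ∈ s} Gr^W_j X`
  (`s` any finite set containing the weights of `X`; the forms with `s = [a, b]` for `W_{a-1} X = 0`, `W_b X = X`, and with `s` = the set of weights).

Everything is PROVED; no definition, no named fact, no instance, no notation; `[HasFiniteBiproducts MixedHodgeStructureCat]` (needed to speak of
`IsSemisimpleObj`) is carried as a hypothesis, as in `Motives/MixedHodgeStructureCatPureObjects`.

Sources, verbatim.  T. Y. Lam, *A First Course in Noncommutative Rings* (2001) [Lam2001FirstCourse], §2 (2.1)(b), Thm. (2.4) (semisimple = every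
submodule a direct summand; cited through the tree's `SemisimpleObjects`).  E. Cattani, F. El Zein, P. A. Griffiths, Lê D. T. (eds.), *Hodge Theory*
(2014) [CattaniElZeinGriffithsLe2014], Ch. 12 footnote 2 (p. 527) (semisimplicity of polarizable ∕ split MHS; cited through `MixedHodgeStructureSemisimple`),
Lemma 3.2.20 (held text p0161 L1: sub-MHS carry induced filtrations).  M. Green, P. Griffiths, M. Kerr, *Mumford–Tate Groups and Domains* (2012)
[GreenGriffithsKerr2012], §I.C footnote 3 (`ℚ`-split MHS).

## Main results

* §1 `coe_subobjectEquiv_bot`, `coe_subobjectEquiv_top`, `coe_subobjectEquiv_inf`, `coe_subobjectEquiv_sup`, `coe_subobjectEquiv_injective`,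
  **`isCompl_coe_subobjectEquiv_iff`**.
* §2 **`complementedLattice_subobject_iff_isSemisimple`**, **`isSemisimpleObj_iff_isSemisimple`**, `isSemisimpleObj_of_isSemisimple`, `IsSemisimpleObj.isSemisimple`.
* §3 **`isSemisimpleObj_iff_isSplitOverQ`**, `IsSemisimpleObj.isSplitOverQ`.
* §4 **`isSemisimpleObj_iff_nonempty_grTotal_obj_iso`**, `IsSemisimpleObj.nonempty_grTotal_obj_iso`, `isSemisimpleObj_of_grTotal_obj_iso`,
  `isSemisimpleObj_iff_nonempty_grTotal_Icc_obj_iso`, `isSemisimpleObj_iff_nonempty_grTotal_weights_obj_iso`.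

## References

* [Lam2001FirstCourse] T. Y. Lam, A First Course in Noncommutative Rings, 2nd ed., GTM 131 (2001), §2 (2.1)(b), Thm. (2.4).
* [CattaniElZeinGriffithsLe2014] E. Cattani et al. (eds.), Hodge Theory, Princeton Math. Notes 49 (2014), Lemma 3.2.20, Ch. 12 footnote 2 (p. 527).
* [GreenGriffithsKerr2012] M. Green, P. Griffiths, M. Kerr, Mumford–Tate Groups and Domains (2012), §I.C (I.C.7), (I.C.11) (iii), footnote 3.
* [VoisinHodgeI2002] C. Voisin, Hodge Theory and Complex Algebraic Geometry I (2002), §7.3.1 Lemma 7.26.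

## Provenance

Lane `lit-hodgefound` (summit `HodgeConjecture`), seat `lit-hodgefound-p36` (literature-prover, generation 44, row g44-#16; §4 appended in generation 45, row g45-#1).
-/

noncomputable section

open CategoryTheory CategoryTheory.Limits

namespace Literature.AlgebraicGeometry.Motives

open Literature.CategoryTheory.KrullSchmidt

universe u

namespace MixedHodgeStructureCat

/-! ## §1 `subobjectEquiv` on `⊥`, `⊤`, `⊓`, `⊔`; complements -/

/-- The zero subobject corresponds to the zero subspace. [cite: CattaniElZeinGriffithsLe2014, Lemma 3.2.20] -/
theorem coe_subobjectEquiv_bot (X : MixedHodgeStructureCat.{u}) : ((subobjectEquiv X ⊥ : X.str.subLattice) : Submodule ℚ X) = ⊥ := by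
  rw [coe_subobjectEquiv_apply, LinearMap.range_eq_bot]
  haveI : Subsingleton ((⊥ : Subobject X) : MixedHodgeStructureCat.{u}) :=
    (isZero_iff_subsingleton _).1 ((CategoryTheory.Limits.isZero_zero MixedHodgeStructureCat.{u}).of_iso Subobject.botCoeIsoZero)
  exact LinearMap.ext fun x => by rw [Subsingleton.elim x 0, map_zero, LinearMap.zero_apply]

/-- The top subobject corresponds to the whole space. [cite: CattaniElZeinGriffithsLe2014, Lemma 3.2.20] -/
theorem coe_subobjectEquiv_top (X : MixedHodgeStructureCat.{u}) : ((subobjectEquiv X ⊤ : X.str.subLattice) : Submodule ℚ X) = ⊤ := by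
  rw [coe_subobjectEquiv_apply, LinearMap.range_eq_top]
  exact ((isIso_iff_bijective _).1 inferInstance).2

/-- `subobjectEquiv` takes `⊓` to `∩` of subspaces. [cite: CattaniElZeinGriffithsLe2014, Lemma 3.2.20] -/
theorem coe_subobjectEquiv_inf (X : MixedHodgeStructureCat.{u}) (a b : Subobject X) :
    ((subobjectEquiv X (a ⊓ b) : X.str.subLattice) : Submodule ℚ X) = (subobjectEquiv X a : Submodule ℚ X) ⊓ (subobjectEquiv X b : Submodule ℚ X) := by
  rw [(subobjectEquiv X).map_inf, Sublattice.coe_inf]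

/-- `subobjectEquiv` takes `⊔` to `+` of subspaces. [cite: CattaniElZeinGriffithsLe2014, Lemma 3.2.20] -/
theorem coe_subobjectEquiv_sup (X : MixedHodgeStructureCat.{u}) (a b : Subobject X) :
    ((subobjectEquiv X (a ⊔ b) : X.str.subLattice) : Submodule ℚ X) = (subobjectEquiv X a : Submodule ℚ X) ⊔ (subobjectEquiv X b : Submodule ℚ X) := by
  rw [(subobjectEquiv X).map_sup, Sublattice.coe_sup]

/-- `S ↦ (subobjectEquiv X S : Submodule)` is injective. [cite: CattaniElZeinGriffithsLe2014, Lemma 3.2.20] -/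
theorem coe_subobjectEquiv_injective (X : MixedHodgeStructureCat.{u}) :
    Function.Injective fun S : Subobject X => ((subobjectEquiv X S : X.str.subLattice) : Submodule ℚ X) :=
  fun _ _ h => (subobjectEquiv X).injective (Subtype.ext h)

/-- **Complementary subobjects correspond to complementary subspaces.** [cite: Lam2001FirstCourse, §2 (2.1)(b)] [cite: CattaniElZeinGriffithsLe2014, Lemma 3.2.20] -/
theorem isCompl_coe_subobjectEquiv_iff (X : MixedHodgeStructureCat.{u}) (a b : Subobject X) :
    IsCompl ((subobjectEquiv X a : X.str.subLattice) : Submodule ℚ X) (subobjectEquiv X b : Submodule ℚ X) ↔ IsCompl a b := by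
  rw [isCompl_iff, isCompl_iff, disjoint_iff, disjoint_iff, codisjoint_iff, codisjoint_iff, ← coe_subobjectEquiv_inf, ← coe_subobjectEquiv_sup,
    ← coe_subobjectEquiv_bot X, ← coe_subobjectEquiv_top X, (coe_subobjectEquiv_injective X).eq_iff, (coe_subobjectEquiv_injective X).eq_iff]

/-! ## §2 `ComplementedLattice (Subobject X) ↔ X.str.IsSemisimple`; `IsSemisimpleObj X ↔ X.str.IsSemisimple` -/

/-- **Every subobject of `X` has a complement iff every sub-MHS of `X` has a complementary sub-MHS.** [cite: Lam2001FirstCourse, §2 (2.1)(b), Thm. (2.4)]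
[cite: CattaniElZeinGriffithsLe2014, Lemma 3.2.20] -/
theorem complementedLattice_subobject_iff_isSemisimple (X : MixedHodgeStructureCat.{u}) : ComplementedLattice (Subobject X) ↔ X.str.IsSemisimple := by
  constructor
  · intro h S
    obtain ⟨b, hab⟩ := h.exists_isCompl ((subobjectEquiv X).symm S.toElt)
    refine ⟨MixedHodgeStructure.SubMixedHodgeStructure.ofElt (subobjectEquiv X b), ?_⟩
    have h' := (isCompl_coe_subobjectEquiv_iff X _ _).2 hab
    rwa [OrderIso.apply_symm_apply] at h'
  · intro h
    refine ⟨fun a => ?_⟩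
    obtain ⟨T, hT⟩ := h (MixedHodgeStructure.SubMixedHodgeStructure.ofElt (subobjectEquiv X a))
    refine ⟨(subobjectEquiv X).symm T.toElt, (isCompl_coe_subobjectEquiv_iff X _ _).1 ?_⟩
    rwa [OrderIso.apply_symm_apply]

section

variable [HasFiniteBiproducts MixedHodgeStructureCat.{u}]

/-- **A finite-dimensional `X` is a semisimple object of `MixedHodgeStructureCat` iff its MHS is semisimple** (every sub-MHS a direct summand).
[cite: Lam2001FirstCourse, §2 Thm. (2.4)] [cite: CattaniElZeinGriffithsLe2014, Ch. 12 footnote 2 (p. 527)] -/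
theorem isSemisimpleObj_iff_isSemisimple (X : MixedHodgeStructureCat.{u}) [Module.Finite ℚ X] : IsSemisimpleObj X ↔ X.str.IsSemisimple := by
  haveI := isArtinianObject_of_finite X
  haveI := isNoetherianObject_of_finite X
  rw [isSemisimpleObj_iff_complementedLattice X, complementedLattice_subobject_iff_isSemisimple]

/-- A semisimple MHS is a semisimple object. [cite: Lam2001FirstCourse, §2 Thm. (2.4)] -/
theorem isSemisimpleObj_of_isSemisimple {X : MixedHodgeStructureCat.{u}} [Module.Finite ℚ X] (h : X.str.IsSemisimple) : IsSemisimpleObj X :=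
  (isSemisimpleObj_iff_isSemisimple X).2 h

/-- A semisimple object has semisimple MHS. [cite: Lam2001FirstCourse, §2 Thm. (2.4)] -/
theorem IsSemisimpleObj.isSemisimple {X : MixedHodgeStructureCat.{u}} [Module.Finite ℚ X] (h : IsSemisimpleObj X) : X.str.IsSemisimple :=
  (isSemisimpleObj_iff_isSemisimple X).1 h

/-! ## §3 Graded-polarizable objects: semisimple ⟺ `ℚ`-split -/

/-- **A graded-polarizable `X` is a semisimple object iff it is split over `ℚ`.** [cite: CattaniElZeinGriffithsLe2014, Ch. 12 footnote 2 (p. 527)]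
[cite: GreenGriffithsKerr2012, §I.C footnote 3] -/
theorem isSemisimpleObj_iff_isSplitOverQ {X : MixedHodgeStructureCat.{u}} (hX : isGradedPolarizable X) : IsSemisimpleObj X ↔ X.str.IsSplitOverQ := by
  haveI := hX.finite
  rw [isSemisimpleObj_iff_isSemisimple, hX.2.isSemisimple_iff_isSplitOverQ]

/-- A graded-polarizable semisimple object is split over `ℚ`. [cite: GreenGriffithsKerr2012, §I.C footnote 3] [cite: CattaniElZeinGriffithsLe2014, Ch. 12 footnote 2 (p. 527)] -/
theorem IsSemisimpleObj.isSplitOverQ {X : MixedHodgeStructureCat.{u}} (hX : isGradedPolarizable X) (h : IsSemisimpleObj X) : X.str.IsSplitOverQ :=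
  (isSemisimpleObj_iff_isSplitOverQ hX).1 h

/-! ## §4 Graded-polarizable objects: semisimple ⟺ isomorphic to the associated weight-graded object -/

/-- **A graded-polarizable `X` is a semisimple object iff `X ≅ ⨁_{j ∈ s} Gr^W_j X`** for any finite set `s` of integers containing the weights
of `X` (semisimple ⟺ `ℚ`-split, §3; `ℚ`-split ⟺ isomorphic to the associated graded, g44-#15). [cite: CattaniElZeinGriffithsLe2014, Ch. 12 footnote 2 (p. 527)]
[cite: GreenGriffithsKerr2012, §I.C (I.C.11) (iii), footnote 3] [cite: VoisinHodgeI2002, §7.3.1 Lemma 7.26] -/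
theorem isSemisimpleObj_iff_nonempty_grTotal_obj_iso (s : Finset ℤ) {X : MixedHodgeStructureCat.{u}} (hX : isGradedPolarizable X)
    (hs : ∀ ⦃j⦄, X.str.IsWeight j → j ∈ s) : IsSemisimpleObj X ↔ Nonempty ((grTotal s).obj X ≅ X) := by
  haveI := hX.finite
  rw [isSemisimpleObj_iff_isSplitOverQ hX, isSplitOverQ_iff_nonempty_grTotal_obj_iso s hs]

/-- A graded-polarizable semisimple object is isomorphic to its associated weight-graded object. [cite: GreenGriffithsKerr2012, §I.C (I.C.11) (iii), footnote 3]
[cite: CattaniElZeinGriffithsLe2014, Ch. 12 footnote 2 (p. 527)] -/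
theorem IsSemisimpleObj.nonempty_grTotal_obj_iso (s : Finset ℤ) {X : MixedHodgeStructureCat.{u}} (hX : isGradedPolarizable X)
    (hs : ∀ ⦃j⦄, X.str.IsWeight j → j ∈ s) (h : IsSemisimpleObj X) : Nonempty ((grTotal s).obj X ≅ X) :=
  (isSemisimpleObj_iff_nonempty_grTotal_obj_iso s hX hs).1 h

/-- An object isomorphic to (a finite sum of) its graded pieces is a semisimple object, for `X` graded-polarizable (no hypothesis on `s`:
`(grTotal s).obj X` is semisimple by g44-#12 `isSemisimpleObj_grTotal_obj`). [cite: VoisinHodgeI2002, §7.3.1 Lemma 7.26]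
[cite: GreenGriffithsKerr2012, §I.C (I.C.11) (iii)] -/
theorem isSemisimpleObj_of_grTotal_obj_iso (s : Finset ℤ) {X : MixedHodgeStructureCat.{u}} (hX : isGradedPolarizable X) (e : (grTotal s).obj X ≅ X) :
    IsSemisimpleObj X :=
  haveI := hX.finite
  isSemisimpleObj_of_isSplitOverQ hX (isSplitOverQ_of_grTotal_obj_iso s e)

/-- **Weights in `[a, b]`**: if `W_{a-1} X = 0` and `W_b X = X`, a graded-polarizable `X` is a semisimple object iff `X ≅ ⨁_{a ≤ j ≤ b} Gr^W_j X`.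
[cite: CattaniElZeinGriffithsLe2014, Ch. 12 footnote 2 (p. 527)] [cite: GreenGriffithsKerr2012, §I.C (I.C.11) (iii), footnote 3] -/
theorem isSemisimpleObj_iff_nonempty_grTotal_Icc_obj_iso {X : MixedHodgeStructureCat.{u}} (hX : isGradedPolarizable X) {a b : ℤ}
    (ha : X.str.W (a - 1) = ⊥) (hb : X.str.W b = ⊤) : IsSemisimpleObj X ↔ Nonempty ((grTotal (Finset.Icc a b)).obj X ≅ X) :=
  isSemisimpleObj_iff_nonempty_grTotal_obj_iso _ hX fun _ hj => hj.mem_Icc ha hb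

/-- **`X` semisimple ⟺ `X ≅ ⨁_{j a weight of X} Gr^W_j X`** (the sum over the finite set of weights of `X`), for `X` graded-polarizable.
[cite: CattaniElZeinGriffithsLe2014, Ch. 12 footnote 2 (p. 527)] [cite: GreenGriffithsKerr2012, §I.C (I.C.11) (iii), footnote 3] -/
theorem isSemisimpleObj_iff_nonempty_grTotal_weights_obj_iso {X : MixedHodgeStructureCat.{u}} (hX : isGradedPolarizable X) :
    IsSemisimpleObj X ↔ Nonempty ((grTotal (MixedHodgeStructure.finite_setOf_isWeight X.str).toFinset).obj X ≅ X) :=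
  isSemisimpleObj_iff_nonempty_grTotal_obj_iso _ hX fun _ hj => (Set.Finite.mem_toFinset _).2 hj

end

end MixedHodgeStructureCat

end Literature.AlgebraicGeometry.Motives

end
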